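import Summits.CriticalPhenomena.PercolationContinuityZ3.Theorems.PercNearOneGluingNoHeavyLowerTailFaceCertKernel
import Summits.CriticalPhenomena.PercolationContinuityZ3.Theorems.PercNearOneGluingNoHeavyLowerTailSahiC3ThreePointCells
import HarnessLib

/-!
# `NoHeavyLowerTail` (stmt-CriticalPhenomena-4575) — Sahi's `C₃` on the three-point connectivity algebra, II: reflection of the cell
# polynomials into `FaceCertKernel.PPoly` and the generic certificate checker

Support file (prover prim-sahi-p2 gen 3; `--supports stmt-CriticalPhenomena-4575`).  No named facts, no sorries; graph-free.

To verify the `238` MEMO-6 certificates `4·E₃ = Σ λ·cell·(T·m(x ∩ y) − m(x)m(y))` (`λ ∈ ℕ` after scaling by `4`) for ALL `2 × 512` ordered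
triples of up-sets / down-sets by ONE `decide` each (files III), the cell polynomials of `…SahiC3ThreePointCells` are reflected into prim-cert-2's
packed polynomials (`FaceCertKernel.PPoly`, Gödel-coded monomials, kernel-evaluable): `XP i` (the five cells as variables `0…4` of the
15-variable context), `TP`, `mUpP` / `mDnP`, `e3hP`, `E3uP` / `E3dP`, the Harris slacks `slackUP` / `slackDP`, and certificates as lists of
entries `(λ, cell, x, y)` (`certUP` / `certDP`).  Soundness: `denote_E3uP : (E3uP j k l).denote = E3u …` etc., and `certUP_nonneg` /
`certDP_nonneg`: a certificate denotes a nonnegative real when the cells are nonnegative and Harris holds pairwise.  The context is `ctx5 cA c0 c1 c2 cS = ctx15 cA c0 c1 c2 cS 0 … 0`.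
-/

noncomputable section

namespace Summit.CriticalPhenomena.PercolationContinuityZ3.Theorems

namespace SahiC3ThreePoint

open FaceCertKernel Lean.Grind.CommRing

/-! ### Reflected cell polynomials -/

/-- The cell variable `i` (`0 = cA, 1 = c0, 2 = c1, 3 = c2, 4 = cS`). [this work] -/
noncomputable def XP (i : Nat) : PPoly := .cons (ptab i) 1 .nil

/-- `p + q`. [this work] -/
noncomputable def addP (p q : PPoly) : PPoly := mergeP p q
/-- `p − q`. [this work] -/
noncomputable def subP (p q : PPoly) : PPoly := mergeP p (smulP (-1) 1 q)

/-- The total mass `T = cA + c0 + c1 + c2 + cS`. [this work] -/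
noncomputable def TP : PPoly := addP (XP 0) (addP (XP 1) (addP (XP 2) (addP (XP 3) (XP 4))))

/-- Reflected `mUp`: `cA + [j0]c0 + [j1]c1 + [j2]c2`. [this work] -/
noncomputable def mUpP (j0 j1 j2 : Bool) : PPoly :=
  addP (XP 0) (addP (cond j0 (XP 1) .nil) (addP (cond j1 (XP 2) .nil) (cond j2 (XP 3) .nil)))

/-- Reflected `mDn`: `cS + [j0]c0 + [j1]c1 + [j2]c2`. [this work] -/
noncomputable def mDnP (j0 j1 j2 : Bool) : PPoly :=
  addP (XP 4) (addP (cond j0 (XP 1) .nil) (addP (cond j1 (XP 2) .nil) (cond j2 (XP 3) .nil)))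

/-- Reflected `e3h`. [this work] -/
noncomputable def e3hP (T m1 m2 m3 m12 m13 m23 m123 : PPoly) : PPoly :=
  subP (addP (smulP 2 1 (mulPP T (mulPP T m123))) (mulPP m1 (mulPP m2 m3)))
    (mulPP T (addP (mulPP m1 m23) (addP (mulPP m2 m13) (mulPP m3 m12))))

/-- Reflected `E3u`. [this work] -/
noncomputable def E3uP (j0 j1 j2 k0 k1 k2 l0 l1 l2 : Bool) : PPoly :=
  e3hP TP (mUpP j0 j1 j2) (mUpP k0 k1 k2) (mUpP l0 l1 l2)
    (mUpP (j0 && k0) (j1 && k1) (j2 && k2)) (mUpP (j0 && l0) (j1 && l1) (j2 && l2))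
    (mUpP (k0 && l0) (k1 && l1) (k2 && l2)) (mUpP (j0 && k0 && l0) (j1 && k1 && l1) (j2 && k2 && l2))

/-- Reflected `E3d`. [this work] -/
noncomputable def E3dP (j0 j1 j2 k0 k1 k2 l0 l1 l2 : Bool) : PPoly :=
  e3hP TP (mDnP j0 j1 j2) (mDnP k0 k1 k2) (mDnP l0 l1 l2)
    (mDnP (j0 && k0) (j1 && k1) (j2 && k2)) (mDnP (j0 && l0) (j1 && l1) (j2 && l2))
    (mDnP (k0 && l0) (k1 && l1) (k2 && l2)) (mDnP (j0 && k0 && l0) (j1 && k1 && l1) (j2 && k2 && l2))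

/-- Reflected Harris slack of two up-sets: `T·mUp(j ∧ k) − mUp j · mUp k`. [this work] -/
noncomputable def slackUP (j0 j1 j2 k0 k1 k2 : Bool) : PPoly :=
  subP (mulPP TP (mUpP (j0 && k0) (j1 && k1) (j2 && k2))) (mulPP (mUpP j0 j1 j2) (mUpP k0 k1 k2))

/-- Reflected Harris slack of two down-sets. [this work] -/
noncomputable def slackDP (j0 j1 j2 k0 k1 k2 : Bool) : PPoly :=
  subP (mulPP TP (mDnP (j0 && k0) (j1 && k1) (j2 && k2))) (mulPP (mDnP j0 j1 j2) (mDnP k0 k1 k2))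

/-- A certificate entry: coefficient `λ ∈ ℕ`, cell index `i`, and a Harris pair `(x, y)` of `Bool³` codes. [this work] -/
structure CE where
  /-- coefficient -/
  lam : Nat
  /-- cell index (variable `0…4`) -/
  i : Nat
  /-- first event -/
  a0 : Bool
  /-- first event -/
  a1 : Bool
  /-- first event -/
  a2 : Bool
  /-- second event -/
  b0 : Bool
  /-- second event -/
  b1 : Bool
  /-- second event -/
  b2 : Bool

/-- The polynomial `Σ λ·xᵢ·slackU(x,y)` of a certificate (raw list recursor, kernel-evaluable). [this work] -/
noncomputable def certUP (L : List CE) : PPoly :=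
  List.rec (motive := fun _ => PPoly) .nil
    (fun e _ ih => mergeP (smulP (Int.ofNat e.lam) (ptab e.i) (slackUP e.a0 e.a1 e.a2 e.b0 e.b1 e.b2)) ih) L

/-- The polynomial `Σ λ·xᵢ·slackD(x,y)` of a certificate. [this work] -/
noncomputable def certDP (L : List CE) : PPoly :=
  List.rec (motive := fun _ => PPoly) .nil
    (fun e _ ih => mergeP (smulP (Int.ofNat e.lam) (ptab e.i) (slackDP e.a0 e.a1 e.a2 e.b0 e.b1 e.b2)) ih) L

/-- All cell indices of a certificate are `< 5`. [this work] -/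
noncomputable def ceOK (L : List CE) : Bool :=
  List.rec (motive := fun _ => Bool) true (fun e _ ih => Nat.blt e.i 5 && ih) L

/-! ### The context and the semantics -/

section Semantics

variable (cA c0 c1 c2 cS : ℝ)

/-- The evaluation context: the five cells as variables `0…4`, zeros beyond. [this work] -/
def ctx5 : Context ℝ := ctx15 cA c0 c1 c2 cS 0 0 0 0 0 0 0 0 0 0

/-- Lookups in `ctx5`. [this work] -/
theorem ctx5_get :
    (ctx5 cA c0 c1 c2 cS).get 0 = cA ∧ (ctx5 cA c0 c1 c2 cS).get 1 = c0 ∧ (ctx5 cA c0 c1 c2 cS).get 2 = c1 ∧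
      (ctx5 cA c0 c1 c2 cS).get 3 = c2 ∧ (ctx5 cA c0 c1 c2 cS).get 4 = cS := by
  simp only [Lean.RArray.get_eq_getImpl, ctx5, ctx15, Lean.RArray.getImpl]
  norm_num

/-- `ctx5` is nonnegative when the cells are. [this work] -/
theorem ctx5_nonneg (hA : 0 ≤ cA) (h0 : 0 ≤ c0) (h1 : 0 ≤ c1) (h2 : 0 ≤ c2) (hS : 0 ≤ cS) :
    ∀ i, i < 15 → 0 ≤ (ctx5 cA c0 c1 c2 cS).get i :=
  ctx15_get_nonneg hA h0 h1 h2 hS le_rfl le_rfl le_rfl le_rfl le_rfl le_rfl le_rfl le_rfl le_rfl le_rfl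

variable {cA c0 c1 c2 cS}

/-- Denotation of a cell variable. [this work] -/
theorem denote_XP (i : Nat) (hi : i < 15) : (XP i).denote (ctx5 cA c0 c1 c2 cS) = (ctx5 cA c0 c1 c2 cS).get i := by
  rw [XP, denote_cons, denote_nil, mono_ptab _ i hi]; push_cast; ring

/-- Denotation of `addP`. [this work] -/
theorem denote_addP (ctx : Context ℝ) (p q : PPoly) : (addP p q).denote ctx = p.denote ctx + q.denote ctx :=
  denote_mergeP ctx p q

/-- Denotation of `subP`. [this work] -/
theorem denote_subP (ctx : Context ℝ) (p q : PPoly) : (subP p q).denote ctx = p.denote ctx - q.denote ctx := by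
  rw [subP, denote_mergeP, denote_smulP, mono_one]; push_cast; ring

/-- Denotation of `TP`. [this work] -/
theorem denote_TP : TP.denote (ctx5 cA c0 c1 c2 cS) = cA + c0 + c1 + c2 + cS := by
  obtain ⟨g0, g1, g2, g3, g4⟩ := ctx5_get cA c0 c1 c2 cS
  simp only [TP, denote_addP, denote_XP _ (by norm_num : (0:ℕ) < 15), denote_XP _ (by norm_num : (1:ℕ) < 15),
    denote_XP _ (by norm_num : (2:ℕ) < 15), denote_XP _ (by norm_num : (3:ℕ) < 15), denote_XP _ (by norm_num : (4:ℕ) < 15),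
    g0, g1, g2, g3, g4]
  ring

/-- Denotation of `mUpP`. [this work] -/
theorem denote_mUpP (j0 j1 j2 : Bool) : (mUpP j0 j1 j2).denote (ctx5 cA c0 c1 c2 cS) = mUp cA c0 c1 c2 j0 j1 j2 := by
  obtain ⟨g0, g1, g2, g3, g4⟩ := ctx5_get cA c0 c1 c2 cS
  cases j0 <;> cases j1 <;> cases j2 <;>
    simp only [mUpP, mUp, cond_true, cond_false, denote_addP, denote_nil, denote_XP _ (by norm_num : (0:ℕ) < 15),
      denote_XP _ (by norm_num : (1:ℕ) < 15), denote_XP _ (by norm_num : (2:ℕ) < 15), denote_XP _ (by norm_num : (3:ℕ) < 15),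
      g0, g1, g2, g3, add_zero, zero_add] <;> ring

/-- Denotation of `mDnP`. [this work] -/
theorem denote_mDnP (j0 j1 j2 : Bool) : (mDnP j0 j1 j2).denote (ctx5 cA c0 c1 c2 cS) = mDn cS c0 c1 c2 j0 j1 j2 := by
  obtain ⟨g0, g1, g2, g3, g4⟩ := ctx5_get cA c0 c1 c2 cS
  cases j0 <;> cases j1 <;> cases j2 <;>
    simp only [mDnP, mDn, cond_true, cond_false, denote_addP, denote_nil, denote_XP _ (by norm_num : (4:ℕ) < 15),
      denote_XP _ (by norm_num : (1:ℕ) < 15), denote_XP _ (by norm_num : (2:ℕ) < 15), denote_XP _ (by norm_num : (3:ℕ) < 15),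
      g4, g1, g2, g3, add_zero, zero_add] <;> ring

/-- Denotation of `e3hP`. [this work] -/
theorem denote_e3hP (ctx : Context ℝ) (T m1 m2 m3 m12 m13 m23 m123 : PPoly) :
    (e3hP T m1 m2 m3 m12 m13 m23 m123).denote ctx =
      e3h (T.denote ctx) (m1.denote ctx) (m2.denote ctx) (m3.denote ctx) (m12.denote ctx) (m13.denote ctx) (m23.denote ctx)
        (m123.denote ctx) := by
  simp only [e3hP, e3h, denote_subP, denote_addP, denote_smulP, denote_mulPP, mono_one]
  push_cast; ring

/-- Denotation of `E3uP` is `E3u`. [this work] -/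
theorem denote_E3uP (j0 j1 j2 k0 k1 k2 l0 l1 l2 : Bool) :
    (E3uP j0 j1 j2 k0 k1 k2 l0 l1 l2).denote (ctx5 cA c0 c1 c2 cS) = E3u cA c0 c1 c2 cS j0 j1 j2 k0 k1 k2 l0 l1 l2 := by
  simp only [E3uP, E3u, denote_e3hP, denote_TP, denote_mUpP]

/-- Denotation of `E3dP` is `E3d`. [this work] -/
theorem denote_E3dP (j0 j1 j2 k0 k1 k2 l0 l1 l2 : Bool) :
    (E3dP j0 j1 j2 k0 k1 k2 l0 l1 l2).denote (ctx5 cA c0 c1 c2 cS) = E3d cA c0 c1 c2 cS j0 j1 j2 k0 k1 k2 l0 l1 l2 := by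
  simp only [E3dP, E3d, denote_e3hP, denote_TP, denote_mDnP]

/-- Denotation of the up-set Harris slack. [this work] -/
theorem denote_slackUP (j0 j1 j2 k0 k1 k2 : Bool) :
    (slackUP j0 j1 j2 k0 k1 k2).denote (ctx5 cA c0 c1 c2 cS) =
      (cA + c0 + c1 + c2 + cS) * mUp cA c0 c1 c2 (j0 && k0) (j1 && k1) (j2 && k2) -
        mUp cA c0 c1 c2 j0 j1 j2 * mUp cA c0 c1 c2 k0 k1 k2 := by
  simp only [slackUP, denote_subP, denote_mulPP, denote_TP, denote_mUpP]

/-- Denotation of the down-set Harris slack. [this work] -/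
theorem denote_slackDP (j0 j1 j2 k0 k1 k2 : Bool) :
    (slackDP j0 j1 j2 k0 k1 k2).denote (ctx5 cA c0 c1 c2 cS) =
      (cA + c0 + c1 + c2 + cS) * mDn cS c0 c1 c2 (j0 && k0) (j1 && k1) (j2 && k2) -
        mDn cS c0 c1 c2 j0 j1 j2 * mDn cS c0 c1 c2 k0 k1 k2 := by
  simp only [slackDP, denote_subP, denote_mulPP, denote_TP, denote_mDnP]

/-- **A certificate with cell indices `< 5` denotes a nonnegative real** when the cells are nonnegative and Harris holds for every
pair of up-sets (each term `λ·cell·slack ≥ 0`). [this work] -/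
theorem certUP_nonneg (hA : 0 ≤ cA) (h0 : 0 ≤ c0) (h1 : 0 ≤ c1) (h2 : 0 ≤ c2) (hS : 0 ≤ cS)
    (hH : ∀ j0 j1 j2 k0 k1 k2 : Bool, mUp cA c0 c1 c2 j0 j1 j2 * mUp cA c0 c1 c2 k0 k1 k2 ≤
      (cA + c0 + c1 + c2 + cS) * mUp cA c0 c1 c2 (j0 && k0) (j1 && k1) (j2 && k2)) :
    ∀ L : List CE, ceOK L = true → 0 ≤ (certUP L).denote (ctx5 cA c0 c1 c2 cS) := by
  have hx := ctx5_nonneg cA c0 c1 c2 cS hA h0 h1 h2 hS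
  intro L
  induction L with
  | nil => intro _; exact le_of_eq (denote_nil _).symm
  | cons e tl ih =>
    intro hok
    have hok' : e.i < 5 ∧ ceOK tl = true := by simpa [ceOK, Nat.blt_eq] using hok
    show 0 ≤ PPoly.denote _ (mergeP (smulP (Int.ofNat e.lam) (ptab e.i) (slackUP e.a0 e.a1 e.a2 e.b0 e.b1 e.b2)) (certUP tl))
    rw [denote_mergeP, denote_smulP, mono_ptab _ e.i (by omega), denote_slackUP]
    refine add_nonneg (mul_nonneg (mul_nonneg ?_ (hx e.i (by omega))) (sub_nonneg.2 (hH _ _ _ _ _ _))) (ih hok'.2)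
    simp

/-- **A certificate with cell indices `< 5` denotes a nonnegative real** when the cells are nonnegative and Harris holds for every
pair of down-sets. [this work] -/
theorem certDP_nonneg (hA : 0 ≤ cA) (h0 : 0 ≤ c0) (h1 : 0 ≤ c1) (h2 : 0 ≤ c2) (hS : 0 ≤ cS)
    (hH : ∀ j0 j1 j2 k0 k1 k2 : Bool, mDn cS c0 c1 c2 j0 j1 j2 * mDn cS c0 c1 c2 k0 k1 k2 ≤
      (cA + c0 + c1 + c2 + cS) * mDn cS c0 c1 c2 (j0 && k0) (j1 && k1) (j2 && k2)) :
    ∀ L : List CE, ceOK L = true → 0 ≤ (certDP L).denote (ctx5 cA c0 c1 c2 cS) := by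
  have hx := ctx5_nonneg cA c0 c1 c2 cS hA h0 h1 h2 hS
  intro L
  induction L with
  | nil => intro _; exact le_of_eq (denote_nil _).symm
  | cons e tl ih =>
    intro hok
    have hok' : e.i < 5 ∧ ceOK tl = true := by simpa [ceOK, Nat.blt_eq] using hok
    show 0 ≤ PPoly.denote _ (mergeP (smulP (Int.ofNat e.lam) (ptab e.i) (slackDP e.a0 e.a1 e.a2 e.b0 e.b1 e.b2)) (certDP tl))
    rw [denote_mergeP, denote_smulP, mono_ptab _ e.i (by omega), denote_slackDP]
    refine add_nonneg (mul_nonneg (mul_nonneg ?_ (hx e.i (by omega))) (sub_nonneg.2 (hH _ _ _ _ _ _))) (ih hok'.2)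
    simp

/-- **Soundness of a checked up-set certificate**: if `4·E3uP ≡ certUP L` (zero test) with `ceOK L`, then `0 ≤ E3u` (nonnegative cells, pairwise Harris). [this work] -/
theorem E3u_nonneg_of_check (hA : 0 ≤ cA) (h0 : 0 ≤ c0) (h1 : 0 ≤ c1) (h2 : 0 ≤ c2) (hS : 0 ≤ cS)
    (hH : ∀ j0 j1 j2 k0 k1 k2 : Bool, mUp cA c0 c1 c2 j0 j1 j2 * mUp cA c0 c1 c2 k0 k1 k2 ≤
      (cA + c0 + c1 + c2 + cS) * mUp cA c0 c1 c2 (j0 && k0) (j1 && k1) (j2 && k2))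
    {j0 j1 j2 k0 k1 k2 l0 l1 l2 : Bool} {L : List CE}
    (hok : ceOK L = true) (hc : subCheckP (smulP 4 1 (E3uP j0 j1 j2 k0 k1 k2 l0 l1 l2)) (certUP L) = true) :
    0 ≤ E3u cA c0 c1 c2 cS j0 j1 j2 k0 k1 k2 l0 l1 l2 := by
  have e1 := denote_eq_of_subCheckP (ctx5 cA c0 c1 c2 cS) _ _ hc
  rw [denote_smulP, mono_one, denote_E3uP] at e1
  have e2 := certUP_nonneg hA h0 h1 h2 hS hH L hok
  rw [← e1] at e2
  push_cast at e2
  linarith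

/-- **Soundness of a checked down-set certificate.** [this work] -/
theorem E3d_nonneg_of_check (hA : 0 ≤ cA) (h0 : 0 ≤ c0) (h1 : 0 ≤ c1) (h2 : 0 ≤ c2) (hS : 0 ≤ cS)
    (hH : ∀ j0 j1 j2 k0 k1 k2 : Bool, mDn cS c0 c1 c2 j0 j1 j2 * mDn cS c0 c1 c2 k0 k1 k2 ≤
      (cA + c0 + c1 + c2 + cS) * mDn cS c0 c1 c2 (j0 && k0) (j1 && k1) (j2 && k2))
    {j0 j1 j2 k0 k1 k2 l0 l1 l2 : Bool} {L : List CE}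
    (hok : ceOK L = true) (hc : subCheckP (smulP 4 1 (E3dP j0 j1 j2 k0 k1 k2 l0 l1 l2)) (certDP L) = true) :
    0 ≤ E3d cA c0 c1 c2 cS j0 j1 j2 k0 k1 k2 l0 l1 l2 := by
  have e1 := denote_eq_of_subCheckP (ctx5 cA c0 c1 c2 cS) _ _ hc
  rw [denote_smulP, mono_one, denote_E3dP] at e1
  have e2 := certDP_nonneg hA h0 h1 h2 hS hH L hok
  rw [← e1] at e2
  push_cast at e2
  linarith

end Semantics

end SahiC3ThreePoint

end Summit.CriticalPhenomena.PercolationContinuityZ3.Theorems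

end
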